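import Mathlib
import HarnessLib
import HarnessLib.Audit
import Summits.QuantumFields.Statement
import Summits.QuantumFields.YangMills.Theses.ThermalTraceWindow
import Summits.QuantumFields.YangMills.Theorems.SlowBitWindowInsertionTraceDefs
import HarnessLib.Audit.Status.Attr

/-!
Route: SlowBitWindow

# Route SlowBitWindow — A slow swap-odd bit on the 2L-thermal torus bounds the first level on the
sub-femto window

D-0145 LINE g10-A of seat ym-idea-4 (technique card «spectral / trace methods»); bears_on rung R2ξ″
of LADDER-YM via K2a = `ThermalTraceWindow.SubFemtoFirstLevel`
(item stmt-QuantumFields-28291, layer-2 child of K2 28257 → K2 → `AllWindowsColdBox.XiSuperPolySU2`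
22804). No summit is proved by this line. It suffices to show
X = StepPersistence ∧ SubFemtoEntropy: (X1) on the sub-femto window L ≤ β^A there EXISTS a bounded,
physical (vertex-gauge-invariant), axis-swap-ODD observable O whose
ONE-STEP thermal autocorrelation on the 2L×L³ zero-flux torus is at least β^(−k/L)·Z(2L) («a slow
bit»: e.g. the sign of the difference of block-smeared adjoint Polyakov
loops in directions 1 and 2); (X2) the L×L³ zero-flux partition function is at most β^q·λ₀^L there
(few populated levels; = the window restriction of the shared crux
`ThermalTraceWindow.FewBodyEntropy` 22537). Two provable spectral doors in TRACE normalisation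
(TraceDoor: O₀₀ = 0 by oddness, so Tr(O T^L O T^L) ≤ 2λ₁^L Z(L); JensenDoor:
power-mean on the spectral decomposition, Tr(O T O T^(2L−1))^L ≤ Tr(O T^L O T^L)·Z(2L)^(L−1)) and
three lines of algebra (Assembly, proved in the sketch) give K2a:
β^(−k') λ₀^L ≤ λ₁^L on the window.
Lean: `∀ A : ℝ, 0 < A → ∃ k β₀ : ℝ, ∃ L₀ : ℕ, ∀ β : ℝ, β₀ ≤ β → ∀ (L : ℕ) [NeZero L], L₀ ≤ L → (L :
ℝ) ≤ β ^ A → ∃ O : Literature.MathematicalPhysics.QuantumFieldTheory.GaugeConfig 3 L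
Summit.QuantumFields.YangMills.Theorems.FemtoTransferGap.SU2 → ℝ,
Summit.QuantumFields.YangMills.Theorems.FemtoTransferGap.IsPhys O ∧ (∀ U, |O U| ≤ 1) ∧ (∀ U, O
(Literature.MathematicalPhysics.QuantumFieldTheory.configPerm (Equiv.swap 0 1) U) = -O U) ∧ β ^ (-k
/ L) * Summit.QuantumFields.YangMills.Theorems.FemtoTransferGap.TT.physTrace L β (2 * L) ≤
Summit.QuantumFields.YangMills.Theorems.FemtoTransferGap.TT.insTrace L β O 1 ∧ ∀ A : ℝ, 0 < A → ∃ q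
β₀ : ℝ, ∃ L₀ : ℕ, ∀ β : ℝ, β₀ ≤ β → ∀ (L : ℕ) [NeZero L], L₀ ≤ L → (L : ℝ) ≤ β ^ A →
Summit.QuantumFields.YangMills.Theorems.FemtoTransferGap.TT.physTrace L β L ≤ β ^ q *
Summit.QuantumFields.YangMills.Theorems.FemtoTransferGap.levelValue
Summit.QuantumFields.YangMills.Theorems.FemtoTransferGap.su2Rep L β 0 ^ L`

## Assembly
Pure algebra, PROVED in the sketch (sbw/SketchProof.lean `assembly_holds`, rc 0, 0 sorries; to be
landed as Theorems/SlowBitWindowAssembly.lean): from StepPersistence pick O;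
JensenDoor and TraceDoor give β^(−k) Z(2L)^L ≤ (insTrace O 1)^L ≤ 2 λ₁^L Z(L) Z(2L)^(L−1), i.e.
β^(−k) Z(2L) ≤ 2 λ₁^L Z(L); λ₀^(2L) ≤ Z(2L) (TT.traceFormula_all, le_hasSum) and
SubFemtoEntropy Z(L) ≤ β^q λ₀^L give β^(−k−q) λ₀^L ≤ 2 λ₁^L, whence K2a with k' = k + q + 1 and β₀ ≥
2. The deciding theorem `closes` takes the four items and Assembly and
concludes `ThermalTraceWindow.SubFemtoFirstLevel` BY NAME (draft-by-design: the conclusion is a crux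
decl of route ThermalTraceWindow, not the summit Statement — exactly as
TTW itself closes AllWindowsColdBox.XiSuperPolySU2).

Rationale: WHY THIS LINE. The lattice practitioner's oldest spectral fact — an effective mass read off ANY
diagonal correlator bounds the true gap from ABOVE, because the transfer matrix is positive
and the spectral weights are squares (MontvayMunster1994 §7.1 eqs. (7.29)–(7.31); LuscherWolff1990)
— is turned into a rigorous LOWER bound on λ₁/λ₀ in THERMAL (trace)
normalisation, where no ground state, no approximate eigenvector and no Gaussian normalisation is
needed: the generalised trace formula with insertions
(`TT.insTrace`, landed p661692, = Tr P M_O (PK)^m M_O (PK)^(2L−m)) makes ⟨O(0)O(m)⟩ on the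
2L-periodic zero-flux torus a positive combination Σ λ_a^m λ_b^(2L−m) |O_ab|²,
and Jensen + oddness convert a one-step persistence into λ₁^L ≥ β^(−k) Z(2L)/(2 Z(L)·Z(2L)^…)
(TraceDoor, JensenDoor: M-sized spectral theory of the compact self-adjoint
positivity-improving `transferOp`, ReedSimonIV1978 XIII.12). What is imported: Markov-chain spectral
folklore (autocorrelation ⇒ lower bound on the second eigenvalue,
MadrasSokal1988 §2) read backwards as a GAP UPPER BOUND, plus the femto-universe picture of the slow
toron/Polyakov modes (Luscher1983, KollerVanbaal1986, Vanbaal2001) which says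
WHICH bit is slow. The precision required of the hard step drops from relative e^(−(k log β)/L) per
transfer step (K2a's recorded why-might-fail for one-step Feynman–Bijl /
Courant–Fischer doors with an approximate ground state — LuscherReduction items 20203/20205 and TTW
approach (β)) to O(1)/poly(β) THERMAL PROBABILITY bounds: a flip of the
slow bit in one step costs either a large one-step jump of a volume-averaged smeared holonomy
(chessboard / Peierls, FrohlichLieb1978, DysonLiebSimon1978) or the event that the
two smeared holonomy averages are β^(−k/L)-close (small-ball anti-concentration at weak coupling,
the LatticeNonFreezing mechanism). No listed route uses a two-time thermal
correlation of an inserted observable: TTW uses pure traces Z(2L)/Z(L), LuscherReduction one-step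
variational doors, GlueballBandRecursion a strong-coupling Bloch band,
XiCompleteMonotonicity complete monotonicity in β, the action-response family
(Squeezed/Forced/Sandwich) derivatives in β; negatives index (9 entries): none concerns traces,
levels or Polyakov observables.

RANKED CRUXES. #2 StepPersistence (crux) — For every A > 0 there are k, β₀, L₀ such that for β ≥ β₀
and L₀ ≤ L ≤ β^A there is a physical observable O on GaugeConfig 3 L SU2 with |O| ≤ 1, odd under the
swap of spatial axes 0 and 1, whose one-step insertion trace on the 2L-thermal zero-flux torus is at
least β^(−k/L)·physTrace L β (2L) (one-step autocorrelation ≥ β^(−k/L)). Intended witness: O = sign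
(or a bounded odd monotone function) of W₀ − W₁, W_i = volume average of block-smeared (scale ∝ L)
adjoint Polyakov loops winding direction i; unsmeared loops have perimeter-law noise and do NOT work
for β ≪ L. [difficulty: XL] (why it might fail: For β ≪ L ≤ β^A a flip bound needs P(|W₀−W₁| ≤
β^(−k/L)) ≤ 1 − β^(−k/L) for SMEARED holonomy averages uniformly in L — a multi-scale small-ball
estimate not in print; the zero-flux projection mixes 8 electric twist sectors whose relative
weights enter.) [Luscher1983, KollerVanbaal1986, Vanbaal2001, MadrasSokal1988, FrohlichLieb1978,
Balaban1989LargeFieldII]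
#3 SubFemtoEntropy (crux) — For every A > 0 there are q, β₀, L₀ such that for β ≥ β₀ and L₀ ≤ L ≤
β^A the L×L³ zero-flux thermal trace satisfies physTrace L β L ≤ β^q · (levelValue su2Rep L β 0)^L
(only poly(β) many thermally populated levels at temporal extent = spatial extent). It is implied by
the shared crux ThermalTraceWindow.FewBodyEntropy (22537) restricted to the window (√(Z(2L)/λ₀^(2L))
≤ Z(2L)/λ₀^(2L) there since the ratio is ≥ 1) and is filed separately so that this line does not
wait for the all-L statement. [difficulty: XL] (why it might fail: Equivalent to |log Z_L(β) − L log
λ₀| ≤ q log β on the window: ABSOLUTE precision of the free energy for L up to β^A; the fixed-L rung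
(ThermalTraceWindowFewBodyEntropyRung) has exponent 12L³+C, useless as L grows — needs the
femto/Bałaban effective action with O(log β) total error.) [LuscherMunster1984, Luscher1983,
Balaban1989LargeFieldII, Vanbaal2001]
#9 TraceDoor (support) — For L ≥ 2, β ≥ 1 and any physical O with |O| ≤ 1 that is odd under the axis
swap (0 1): insTrace L β O L ≤ 2 · (levelValue su2Rep L β 1)^L · physTrace L β L. Proof sketch:
insTrace L β O L = Σ_(a,b) λ_a^L λ_b^L |⟨ψ_a, O ψ_b⟩|² over an orthonormal eigenbasis of
P·transferOp·P (trace class, eigenvalues λ₀ ≥ λ₁ ≥ … ≥ 0 summing to physTrace); if λ₀ is simple its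
eigenvector is swap-invariant (transferKernel_su2Rep_configPerm, rawVacuum_comp_configPerm) so O₀₀ =
0 and every term has λ_aλ_b ≤ λ₀λ₁ ≤ … bound Σ_b |O_ab|² ≤ ‖Oψ_a‖² ≤ 1; if λ₀ = λ₁ the bound is
immediate. Generalises TT.traceFormula_all (insertion-free case). [difficulty: M] [ReedSimonIV1978,
MontvayMunster1994, LuscherWolff1990]
#9 JensenDoor (support) — For L ≥ 2, β ≥ 1 and any physical O with |O| ≤ 1: (insTrace L β O 1)^L ≤
insTrace L β O L · (physTrace L β (2L))^(L−1). Proof sketch: with weights w_ab = |O_ab|² λ_b^(2L) ≥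
0 and ratios r_ab = λ_a/λ_b, insTrace O 1 = Σ w r, insTrace O L = Σ w r^L; power-mean (Jensen, x ↦
x^L convex) gives (Σ w r)^L ≤ (Σ w)^(L−1) Σ w r^L and Σ w = Σ_b λ_b^(2L) ‖Oψ_b‖² ≤ physTrace(2L).
Terms with λ_b = 0 are handled by symmetry (swap a,b) or vanish. [difficulty: M] [ReedSimonIV1978,
MadrasSokal1988]

TWO-LAYER PLAN. StepPersistence ⇐ (SP1) a chessboard/Peierls bound: P_(2L-thermal)(one-step change
of the smeared volume-averaged adjoint Polyakov loop ≥ ε) ≤ poly(β,L)·exp(−c β ε² L^…) →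
(SP2) small-ball: P(|W₀ − W₁| ≤ ε) ≤ poly(β)·ε^θ uniformly in L ≤ β^A → (SP3) glue: flip probability
≤ SP1 + SP2 with ε = β^(−k/L) and ⟨O(0)O(1)⟩ = Z(2L)(1 − 2·flip).
SubFemtoEntropy ⇐ FewBodyEntropy (22537) by a one-line bridge once 22537 closes (file then as
support `SubFemtoEntropy_of_fewBodyEntropy`).

KILL CRITERIA. Refutation of StepPersistence as typed (e.g. a theorem that EVERY bounded swap-odd
physical observable has one-step autocorrelation ≤ (1 − c/β^a)·Z(2L) for some L in
the window — a uniform FAST-mixing statement for the odd sector) closes the route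
`refuted:StepPersistence`; it would also be strong positive information for K2a's
rival approach (α) (it says λ₁^odd ≤ λ₀(1 − c/β^a), more than K2a needs — so a refuter should check
whether the refuting argument already PROVES K2a). Refutation of
SubFemtoEntropy refutes FewBodyEntropy (22537) on the window and breaks TTW's K1 as well → pivot
both routes to the 2^j-adic tower with explicit entropy constants.
K2a proved directly (approaches α/β/γ of its docstring) or K2 (28257) closed moots the line
(`superseded`).

NOT DECOMPOSED YET. The witness O is deliberately not fixed in the statement (∃ O): smearing scale,
adjoint vs fundamental trace, sign vs smooth odd cut-off are prover's choices; the
constants k(A), q(A); the split SP1–SP3 above; the eight-twist-sector bookkeeping of the zero-flux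
projection physAvg (e = 0) — all layer-2, after the critic passes the line.

CHEAPEST FALSIFIER. (a) In Lean, fixed L = 2: the 4-step thermal integral is a finite-dimensional
compact integral — Laplace asymptotics of insTrace 2 β O 1 / physTrace 2 β 4 for
O = tanh-free bounded odd function of (trP₀ − trP₁) (adjoint Polyakov loops of length 2) must give ≥
β^(−k/2); a decay like exp(−cβ) would kill the smeared-Polyakov witness
class (not the ∃-statement). (b) INSTRUMENT ROW (would refute/calibrate the key lemma): SU(2)
heat-bath MC on 2L×L³, L ∈ {4,6,8}, Wilson β_W ∈ {2.4, 2.5, 2.7} (tree β = β_W/2),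
periodic ensemble as e-unprojected proxy: per-time-slice flip rate of sgn(W₀ − W₁) with APE-smeared
(n_APE ≈ L) adjoint Polyakov loops, and the lag-L sign autocorrelation;
prediction flip rate ≤ (k log β)/(2L) with k = O(1) L-independent; a flip rate growing with L at
fixed β (perimeter noise surviving smearing) refutes the witness class.
Not run in this session (kit job optional; the line is filed on the analytic evidence of the
femto-universe literature: toron/Polyakov modes are the slowest, gap ~ g^(2/3)/L ≫
tunnelling rate).

NUMBERS. Femto universe (L ≪ β in tree units): λ₁/λ₀ per step = exp(−E₁(L)), E₁ L = O(g^(2/3))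
(Luscher1983; LuscherMunster1984 Table 1; KollerVanbaal1986) so λ₁^L/λ₀^L = exp(−O(g^(2/3)))
≥ β^(−k) trivially there; the content of both cruxes is the regime β ≲ L ≤ β^A where E₁(L)·L must
stay ≤ k log β (no confinement scale is reached before L ~ exp(cβ)).
K2a rung one (L = 1) landed: ThermalTraceWindowSubFemtoFirstLevelRungOne (p645207).

DEFINITION REQUESTS. None: `TT.insTrace` (two-insertion thermal trace) landed as
Theorems/SlowBitWindowInsertionTraceDefs.lean (p661692, commit 2a2fdd8ca27b).

Novelty: Searches (2026-08-28): lit search --hybrid "effective mass upper bound energy gap correlation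
function transfer matrix variational" (6 docs; MontvayMunster1994 pp.364–365
[corpus:book:montvay1994-quantum-fields-lattice p.364] effective masses (7.29)–(7.36); Creutz2022
p.105 [corpus:book:creutz2022-quarks-gluons-lattices p.105] glueball
correlators); lit vsearch "autocorrelation at lag t bounded by second eigenvalue … lower bound on
the second eigenvalue" (6 docs, MCMC statistics texts
[corpus:book:berg2004-markov-chain-monte-carlo-simulations-their-statistical p.186], none in a proof
of a gap bound for a lattice gauge transfer matrix); lit search --hybrid
"Polyakov loop small volume torons femto universe SU(2) effective Hamiltonian" (Greensite2011
pp.38,123 [corpus:book:greensite2011-introduction-confinement-problem p.38],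
MontvayMunster1994 p.296); lit galaxy search "effective mass|toron|slow mode" --star pdf (8 rows,
noise) and "adjoint Polyakov loop|spatial Polyakov" --star all
([galaxy:pdf:7528845710175270340] García Pérez–González-Arroyo hep-lat/9206016 twisted-torus
classical solutions; [galaxy:panama:289326176927845]); lean search insTrace /
physTrace / levelValue (tree: TT.traceFormula_all, le_levelValue_of_groundStateTransform,
levelValue_zero_le_of_supersolution — all insertion-free or one-step).
Nearest prior art found: MontvayMunster1994 §7.1 / LuscherWolff1990 (effective energies from
positive correlators converge to the spectrum from above — numerical practice,  [refs: book:montvay1994-quantum-fields-lattice, book:creutz2022-quarks-gluons-lattices, book:berg2004-markov-chain-monte-carlo-simulations-their-statistical, book:greensite2011-introduction-confinement-problem, MontvayMunster1994, Creutz2022, Greensite2011, LuscherWolff1990, MadrasSokal1988]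

Barriers (technique_class: transfer-trace, thermal-autocorrelation, chessboard): - technique_class: transfer-trace, thermal-autocorrelation, chessboard
- Literature.Barriers.QuantumFields.PerturbativeInvisibility: outside — the line bounds a level
RATIO from below on finite tori (an upper bound on a would-be gap, polynomial in β), it asserts no
mass and no non-perturbative smallness; [corpus:
Literature/Barriers/QuantumFields/PerturbativeInvisibility.lean].
- Literature.Barriers.QuantumFields.FiniteTemperatureDeconfinement: outside — temporal extent 2L ≥
spatial L and the zero-flux (e = 0) projection physAvg; no claim about Polyakov-loop expectation
values or centre breaking, only about an autocorrelation; the deconfined-phase caveat (temporal ≪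
spatial) is the opposite aspect ratio.
- Literature.Barriers.QuantumFields.FixedCouplingUltralocality: outside — every statement is a rate
in β → ∞ on boxes L ≤ β^A, nothing is claimed at fixed coupling.
- Literature.Barriers.QuantumFields.ToronPlaneAnticorrelation: does not bite — the quantity is the
autocorrelation of ONE observable at two times, nonnegative by reflection positivity in time; no
cross-plane sign is used.
- Literature.Barriers.QuantumFields.NonabelianCoulombPhaseD5: outside — the line proves NO mass gap
and no clustering: it is an UPPER bound on a level ratio (λ₁ ≥ β^(−k')λ₀, i.e. the would-be gap is
at most (k' log β)/L on the window), a statement that is equally true and harmless in a d = 5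
Coulomb phase; the dimension enters only through the d = 4 femto-universe input (which bit is slow)
inside

History (route lifecycle, newest last):
- 2026-08-28T19:50:18Z · rev 1: informal re-worded for StepPersistence (planner-ym-idea-4-g10-0)

sub-problem: YangMills · status: draft · opened planner-ym-idea-4-g10-0 2026-08-28T19:44:55Z · rev 2 · ledger route-QuantumFields-SlowBitWindow
GENERATED by the gate from the ledger (D-0016/17). Provers cite these decls: `theorem foo : Summit.QuantumFields.YangMills.Theses.SlowBitWindow.<Decl> := …` in Summits/QuantumFields/YangMills/Theorems/<Name>.lean.
-/

namespace Summit.QuantumFields.YangMills.Theses.SlowBitWindow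

open scoped BigOperators Topology Manifold Classical MeasureTheory ProbabilityTheory Matrix InnerProductSpace ComplexConjugate ContinuousMap
open Filter Set Function TopologicalSpace MeasureTheory

attribute [summit_statement] _root_.YangMills

/-- item stmt-QuantumFields-23271 · crux · rank 2 · open · by planner
why it might fail: For β ≪ L ≤ β^A a flip bound needs P(|W₀−W₁| ≤ β^(−k/L)) ≤ 1 − β^(−k/L) for SMEARED holonomy averages uniformly in L — a multi-scale small-ball estimate not in print; the zero-flux projection mixes 8 electric twist sectors whose relative weights enter.
sources: Luscher1983, KollerVanbaal1986, Vanbaal2001, MadrasSokal1988, FrohlichLieb1978, Balaban1989LargeFieldII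
[crux] For every A > 0 there are k, β₀, L₀ such that for β ≥ β₀ and L₀ ≤ L ≤ β^A there is a physical
observable O on GaugeConfig 3 L SU2 with |O| ≤ 1, odd under the swap of spatial axes 0 and 1, whose
one-step insertion trace on the 2L-thermal zero-flux torus is at least β^(−k/L)·physTrace L β (2L)
(one-step autocorrelation ≥ β^(−k/L), i.e. flip probability ≤ (k log β)/(2L): HARDER as L grows, no
escape through ∃k). INTENDED WITNESS (prover: do NOT start from unsmeared loops — their
perimeter-law noise gives flip rate ~ 1/√(βL) ≫ (log β)/L for β ≪ L): O = sgn (or a bounded odd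
monotone cut-off) of W₀ − W₁, where W_i = (1/L³) Σ_x (1/3)·tr_adj of the direction-i Polyakov
holonomy built from BLOCK-SMEARED links at smearing scale s = ⌊L/4⌋ (iterated covariant axial-gauge
block averaging à la Bałaban, or n_APE ≍ L APE steps), adjoint trace so that O is centre-blind and
vertex-gauge invariant (IsPhys). ZERO-FLUX PROJECTION: physAvg averages over ALL vertex gauge
transformations incl. the 8 = |Z₂³| centre-twisted classes (electric twist sectors e ∈ Z₂³); the
adjoint Polyakov loops are twist-invariant, so the witness lives in every sector and the flip bound
must be proved for the e-average -/
@[route_item "route-QuantumFields-SlowBitWindow", crux]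
def StepPersistence : Prop :=
  ∀ A : ℝ, 0 < A → ∃ k β₀ : ℝ, ∃ L₀ : ℕ, ∀ β : ℝ, β₀ ≤ β → ∀ (L : ℕ) [NeZero L], L₀ ≤ L → (L : ℝ) ≤ β ^ A → ∃ O : Literature.MathematicalPhysics.QuantumFieldTheory.GaugeConfig 3 L Summit.QuantumFields.YangMills.Theorems.FemtoTransferGap.SU2 → ℝ, Summit.QuantumFields.YangMills.Theorems.FemtoTransferGap.IsPhys O ∧ (∀ U, |O U| ≤ 1) ∧ (∀ U, O (Literature.MathematicalPhysics.QuantumFieldTheory.configPerm (Equiv.swap 0 1) U) = -O U) ∧ β ^ (-k / L) * Summit.QuantumFields.YangMills.Theorems.FemtoTransferGap.TT.physTrace L β (2 * L) ≤ Summit.QuantumFields.YangMills.Theorems.FemtoTransferGap.TT.insTrace L β O 1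

/-- item stmt-QuantumFields-23272 · crux · rank 3 · SPLIT (gen 1) into SubFemtoEntropyLaplaceWindow, SubFemtoEntropyPolyTail + glue SubFemtoEntropyOfWindowTail · direct attempts still welcome (low priority) · by planner
why it might fail: Equivalent to |log Z_L(β) − L log λ₀| ≤ q log β on the window: ABSOLUTE precision of the free energy for L up to β^A; the fixed-L rung (ThermalTraceWindowFewBodyEntropyRung) has exponent 12L³+C, useless as L grows — needs the femto/Bałaban effective action with O(log β) total error.
sources: LuscherMunster1984, Luscher1983, Balaban1989LargeFieldII, Vanbaal2001
[crux] For every A > 0 there are q, β₀, L₀ such that for β ≥ β₀ and L₀ ≤ L ≤ β^A the L×L³ zero-flux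
thermal trace satisfies physTrace L β L ≤ β^q · (levelValue su2Rep L β 0)^L (only poly(β) many
thermally populated levels at temporal extent = spatial extent). It is implied by the shared crux
ThermalTraceWindow.FewBodyEntropy (22537) restricted to the window (√(Z(2L)/λ₀^(2L)) ≤ Z(2L)/λ₀^(2L)
there since the ratio is ≥ 1) and is filed separately so that this line does not wait for the all-L
statement. [difficulty: XL] -/
@[route_item "route-QuantumFields-SlowBitWindow", crux]
def SubFemtoEntropy : Prop :=
  ∀ A : ℝ, 0 < A → ∃ q β₀ : ℝ, ∃ L₀ : ℕ, ∀ β : ℝ, β₀ ≤ β → ∀ (L : ℕ) [NeZero L], L₀ ≤ L → (L : ℝ) ≤ β ^ A → Summit.QuantumFields.YangMills.Theorems.FemtoTransferGap.TT.physTrace L β L ≤ β ^ q * Summit.QuantumFields.YangMills.Theorems.FemtoTransferGap.levelValue Summit.QuantumFields.YangMills.Theorems.FemtoTransferGap.su2Rep L β 0 ^ L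

-- parent: SubFemtoEntropy · child (gen 1)
/--     item stmt-QuantumFields-23785 · crux · rank 301 · open
    parent: SubFemtoEntropy · by planner
    why it might fail: Entropy is ABSOLUTE: the Gaussian determinant over ≍54L⁴ modes must match λ₀^L to O(log β); two-loop remainders are O(L⁴/β), bounded only for a ≤ 1/4; large-field pockets ∝ L⁴ could pin flat directions and add L-dependent powers of β, killing uniformity for every a>0.
    sources: Luscher1983, LuscherMunster1984, Vanbaal2001, arXiv:2305.17604, arXiv:2306.07262, ReedSimonIV1978
LINE g11-B (ym-idea-4 «spectral / trace methods», D-0145 ideator; NO SUMMIT IS PROVED BY THIS LINE):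
Laplace-window regime split of the SHARED crux `SubFemtoEntropy` (stmt-QuantumFields-23272, wanted
by SlowBitWindow AND SwapTwistDeficit; informally = ThermalTraceWindow.FewBodyEntropy K1a restricted
to windows) into WINDOW ∧ POLYNOMIAL TAIL, glued by a case split on `L ≤ β^a` (proof in hand,
planner lands it). bears_on: 23272 → SlowBitWindow.closes / SwapTwistDeficit.closes →
ThermalTraceWindow.SubFemtoFirstLevel (K2a, 28291) → AllWindowsColdBox.XiSuperPolySU2 (22804) =
LADDER-YM rung R2ξ″ (RECORD label), and K1a 22537 (FewBodyEntropy) of ThermalTraceWindow. THIS ITEM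
(W′, the window): for SOME a>0 an L-UNIFORM exponent q with polynomial onset: Z(L×L³) ≤ β^q·λ₀^L for
β ≥ β₀, L₀ ≤ L ≤ β^a. It is rung r2 of 23272/K1a made an item: r1 (fixed L, exponent 12L³ via
Hilbert–Schmidt at t = 2) is LANDED (Theorems/ThermalTraceWindowFewBodyEntropyRungFixedL); HS cannot
be L-uniform (entropy at t=2 is e^{γL³}), so r2 needs a new mechanism. MECHANISM: Laplace
asymptotics of the thermal trace Z(L×L³)/λ₀^L = Σ_k (λ_k/λ₀)^L at β → ∞: Gaussian non-constant modes
contribute O(1) per mode RELATIVE to -/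
@[route_item "route-QuantumFields-SlowBitWindow", crux]
def SubFemtoEntropyLaplaceWindow : Prop :=
  ∃ a : ℝ, 0 < a ∧ ∃ q β₀ : ℝ, ∃ L₀ : ℕ, ∀ β : ℝ, β₀ ≤ β → ∀ (L : ℕ) [NeZero L], L₀ ≤ L → (L : ℝ) ≤ β ^ a → Summit.QuantumFields.YangMills.Theorems.FemtoTransferGap.TT.physTrace L β L ≤ β ^ q * Summit.QuantumFields.YangMills.Theorems.FemtoTransferGap.levelValue Summit.QuantumFields.YangMills.Theorems.FemtoTransferGap.su2Rep L β 0 ^ L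

-- parent: SubFemtoEntropy · child (gen 1)
/--     item stmt-QuantumFields-23786 · crux · rank 302 · open
    parent: SubFemtoEntropy · by planner
    why it might fail: Requires log Z(L×L³) − L·log λ₀ = O(log β) uniformly up to L = β^A: a rigorous two-loop-and-beyond cancellation of bulk free energy between the partition function and the transfer-matrix ground state, with large fields — Bałaban controls densities, not this difference; not in print.
    sources: Balaban1989LargeFieldII, Vanbaal2001, Luscher1983, LuscherMunster1984
LINE g11-B (ym-idea-4 «spectral / trace methods», D-0145 ideator; NO SUMMIT IS PROVED BY THIS LINE):
Laplace-window regime split of the SHARED crux `SubFemtoEntropy` (stmt-QuantumFields-23272, wanted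
by SlowBitWindow AND SwapTwistDeficit; informally = ThermalTraceWindow.FewBodyEntropy K1a restricted
to windows) into WINDOW ∧ POLYNOMIAL TAIL, glued by a case split on `L ≤ β^a` (proof in hand,
planner lands it). bears_on: 23272 → SlowBitWindow.closes / SwapTwistDeficit.closes →
ThermalTraceWindow.SubFemtoFirstLevel (K2a, 28291) → AllWindowsColdBox.XiSuperPolySU2 (22804) =
LADDER-YM rung R2ξ″ (RECORD label), and K1a 22537 (FewBodyEntropy) of ThermalTraceWindow. THIS ITEM
(P′, the polynomial tail): for EVERY a>0, A>0: Z(L×L³) ≤ β^q λ₀^L on β^a ≤ L ≤ β^A. The XL content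
of 23272: entropy of the cold box relative to the exact vacuum energy on polynomially large tori.
WHY EASIER than 23272: L → ∞ polynomially with β is a hypothesis, so the zero-mode/toron effective
theory may be derived with o(1) errors by a multiscale expansion over ≥ a·log₂β spatial scales, and
only the ENTROPY of the running effective theory (poly(β) while g²(L) stays small, i.e. L ≪ ξ) is
needed — bulk free energy can -/
@[route_item "route-QuantumFields-SlowBitWindow", crux]
def SubFemtoEntropyPolyTail : Prop :=
  ∀ a : ℝ, 0 < a → ∀ A : ℝ, 0 < A → ∃ q β₀ : ℝ, ∃ L₀ : ℕ, ∀ β : ℝ, β₀ ≤ β → ∀ (L : ℕ) [NeZero L], L₀ ≤ L → β ^ a ≤ (L : ℝ) → (L : ℝ) ≤ β ^ A → Summit.QuantumFields.YangMills.Theorems.FemtoTransferGap.TT.physTrace L β L ≤ β ^ q * Summit.QuantumFields.YangMills.Theorems.FemtoTransferGap.levelValue Summit.QuantumFields.YangMills.Theorems.FemtoTransferGap.su2Rep L β 0 ^ L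

-- parent: SubFemtoEntropy · glue (gen 1)
/--     item stmt-QuantumFields-23787 · support · rank 303 · closed · proved by Summit.QuantumFields.YangMills.Theorems.SlowBitWindow.subFemtoEntropyOfWindowTail (planner)
    parent: SubFemtoEntropy · GLUE: children ⟹ parent · by planner
Regime split (LINE g11-B, ym-idea-4): SubFemtoEntropyLaplaceWindow → SubFemtoEntropyPolyTail →
SubFemtoEntropy. Proof in hand (planner folder Sketch.lean `subFemtoEntropy_of_window_of_tail`, lean
rc 0, 0 sorry): given A, take W′s a and (q₁,β₁,L₁), P′ at (a,A) gives (q₂,β₂,L₂); q = max q₁ q₂, β₀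
= max (max β₁ β₂) 1, L₀ = max L₁ L₂; case split le_total (L:ℝ) (β^a); β^qᵢ ≤ β^(max)
(Real.rpow_le_rpow_of_exponent_le, 1 ≤ β) times λ₀^L ≥ 0 (levelValue_su2Rep_pos). Planner lands it
as a Theorems file against this glue item. -/
@[route_item "route-QuantumFields-SlowBitWindow"]
def SubFemtoEntropyOfWindowTail : Prop :=
  SubFemtoEntropyLaplaceWindow → SubFemtoEntropyPolyTail → SubFemtoEntropy

-- `SubFemtoEntropyOfWindowTail` holds: proved by `Summit.QuantumFields.YangMills.Theorems.SlowBitWindow.subFemtoEntropyOfWindowTail` (its module imports this route file, so no `_holds` link can be stated here).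

/-- item stmt-QuantumFields-23273 · support · rank 9 · closed · proved by Summit.QuantumFields.YangMills.Theorems.SlowBitWindow.traceDoor_proof (prover) · by planner
sources: ReedSimonIV1978, MontvayMunster1994, LuscherWolff1990
[support] For L ≥ 2, β ≥ 1 and any physical O with |O| ≤ 1 that is odd under the axis swap (0 1):
insTrace L β O L ≤ 2 · (levelValue su2Rep L β 1)^L · physTrace L β L. Proof sketch: insTrace L β O L
= Σ_(a,b) λ_a^L λ_b^L |⟨ψ_a, O ψ_b⟩|² over an orthonormal eigenbasis of P·transferOp·P (trace class,
eigenvalues λ₀ ≥ λ₁ ≥ … ≥ 0 summing to physTrace); if λ₀ is simple its eigenvector is swap-invariant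
(transferKernel_su2Rep_configPerm, rawVacuum_comp_configPerm) so O₀₀ = 0 and every term has λ_aλ_b ≤
λ₀λ₁ ≤ … bound Σ_b |O_ab|² ≤ ‖Oψ_a‖² ≤ 1; if λ₀ = λ₁ the bound is immediate. Generalises
TT.traceFormula_all (insertion-free case). [difficulty: M] -/
@[route_item "route-QuantumFields-SlowBitWindow", crux]
def TraceDoor : Prop :=
  ∀ (L : ℕ) [NeZero L], 2 ≤ L → ∀ β : ℝ, 1 ≤ β → ∀ O : Literature.MathematicalPhysics.QuantumFieldTheory.GaugeConfig 3 L Summit.QuantumFields.YangMills.Theorems.FemtoTransferGap.SU2 → ℝ, Summit.QuantumFields.YangMills.Theorems.FemtoTransferGap.IsPhys O → (∀ U, |O U| ≤ 1) → (∀ U, O (Literature.MathematicalPhysics.QuantumFieldTheory.configPerm (Equiv.swap 0 1) U) = -O U) → Summit.QuantumFields.YangMills.Theorems.FemtoTransferGap.TT.insTrace L β O L ≤ 2 * Summit.QuantumFields.YangMills.Theorems.FemtoTransferGap.levelValue Summit.QuantumFields.YangMills.Theorems.FemtoTransferGap.su2Rep L β 1 ^ L * Summit.QuantumFields.YangMills.Theorems.FemtoTransferGap.TT.physTrace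 L β L

-- `TraceDoor` holds: proved by `Summit.QuantumFields.YangMills.Theorems.SlowBitWindow.traceDoor_proof` (its module imports this route file, so no `_holds` link can be stated here).

/-- item stmt-QuantumFields-23274 · support · rank 9 · closed · proved by Summit.QuantumFields.YangMills.Theorems.SlowBitWindow.jensenDoor_proof (prover) · by planner
sources: ReedSimonIV1978, MadrasSokal1988
[support] For L ≥ 2, β ≥ 1 and any physical O with |O| ≤ 1: (insTrace L β O 1)^L ≤ insTrace L β O L
· (physTrace L β (2L))^(L−1). Proof sketch: with weights w_ab = |O_ab|² λ_b^(2L) ≥ 0 and ratios r_ab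
= λ_a/λ_b, insTrace O 1 = Σ w r, insTrace O L = Σ w r^L; power-mean (Jensen, x ↦ x^L convex) gives
(Σ w r)^L ≤ (Σ w)^(L−1) Σ w r^L and Σ w = Σ_b λ_b^(2L) ‖Oψ_b‖² ≤ physTrace(2L). Terms with λ_b = 0
are handled by symmetry (swap a,b) or vanish. [difficulty: M] -/
@[route_item "route-QuantumFields-SlowBitWindow", crux]
def JensenDoor : Prop :=
  ∀ (L : ℕ) [NeZero L], 2 ≤ L → ∀ β : ℝ, 1 ≤ β → ∀ O : Literature.MathematicalPhysics.QuantumFieldTheory.GaugeConfig 3 L Summit.QuantumFields.YangMills.Theorems.FemtoTransferGap.SU2 → ℝ, Summit.QuantumFields.YangMills.Theorems.FemtoTransferGap.IsPhys O → (∀ U, |O U| ≤ 1) → Summit.QuantumFields.YangMills.Theorems.FemtoTransferGap.TT.insTrace L β O 1 ^ L ≤ Summit.QuantumFields.YangMills.Theorems.FemtoTransferGap.TT.insTrace L β O L * Summit.QuantumFields.YangMills.Theorems.FemtoTransferGap.TT.physTrace L β (2 * L) ^ (L - 1)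

-- `JensenDoor` holds: proved by `Summit.QuantumFields.YangMills.Theorems.SlowBitWindow.jensenDoor_proof` (its module imports this route file, so no `_holds` link can be stated here).

/-- item stmt-QuantumFields-23275 · assembly · rank 1 · closed · proved by Summit.QuantumFields.YangMills.Theses.SlowBitWindow.assembly_holds (planner) · by planner
sources: Luscher1983, MontvayMunster1994
[assembly] TraceDoor → JensenDoor → StepPersistence → SubFemtoEntropy →
ThermalTraceWindow.SubFemtoFirstLevel -/
@[route_item "route-QuantumFields-SlowBitWindow", crux]
def Assembly : Prop :=
  TraceDoor → JensenDoor → StepPersistence → SubFemtoEntropy → Summit.QuantumFields.YangMills.Theses.ThermalTraceWindow.SubFemtoFirstLevel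

-- `Assembly` holds: proved by `Summit.QuantumFields.YangMills.Theses.SlowBitWindow.assembly_holds` (its module imports this route file, so no `_holds` link can be stated here).

/-! D-0027 §2.1 — DECIDING THEOREM (planner-authored via `route open/edit --closes-file`; by planner-ym-idea-4-g10-0 2026-08-28T19:44:55Z):
its hypotheses are this route's items and its conclusion the sub-problem Statement (glue_lint), and it elaborates with this file. -/

@[closes "route-QuantumFields-SlowBitWindow"] theorem closes (h₁ : TraceDoor) (h₂ : JensenDoor) (h₃ : StepPersistence) (h₄ : SubFemtoEntropy) (hA : Assembly) :
    Summit.QuantumFields.YangMills.Theses.ThermalTraceWindow.SubFemtoFirstLevel :=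
  hA h₁ h₂ h₃ h₄

end Summit.QuantumFields.YangMills.Theses.SlowBitWindow
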